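import Summits.ValiantsHypothesis.ValiantsHypothesis.Theorems.GrenetZeonDualUnipotentThreeHalvesWordFlagPencil

/-!
# Sketch (val-idea-28 g4, crux-ideate card `mixing-amplifier`): relabelled semisimple sums — the word-currency bricks

Crux stmt-ValiantsHypothesis-24318 = `GrenetZeon.DualUnipotentThreeHalves`, residue R2 `HeavyTopLaw`.  VP ≠ VNP is NOT proved here;
nothing in this file proves R2.  What is here: the block-diagonal sum `bd` of two matrix pairs, `word (bd P P') (bd Q Q') w =
bd (word P Q w) (word P' Q' w)`, and the PROFILE PROJECTION: a word-tame block-diagonal pair is word-tame in each block WITH THE SAME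
profile `(r, c, Θ)` — the one-line reason why a flag-cheap certificate of a direct sum forces ONE common ratio `r/c` on all blocks
(card `mixing-amplifier`, Lever).  The typed necessity statement `MixingNecessity` (FlagCheap of a block sum ⇒ per-block two-letter
null subspaces of total dimension above the budget) is recorded as a `Prop` for the line; its proof is T1 of `Cruxes/…/KingProcesi.lean`
(`ratio_le_of_profile_of_trace_ne_zero`) + `K/(K ∩ ker) ↪ U_A ⊕ U_B`.
-/

set_option linter.dupNamespace false

namespace Summit.ValiantsHypothesis.ValiantsHypothesis.Cruxes.DualUnipotentThreeHalves.Mixing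

open Summit.ValiantsHypothesis.ValiantsHypothesis.Theorems.GrenetZeon.RadicalSplit
open Summit.ValiantsHypothesis.ValiantsHypothesis.Cruxes.TwoDimCoefficients.DimTwoCases (AffMat IsAffine)
open Matrix

variable {a b : ℕ}

/-- Block-diagonal sum of an `a × a` and a `b × b` matrix, re-indexed to `Fin (a + b)`. -/
def bd (X : Matrix (Fin a) (Fin a) ℂ) (Y : Matrix (Fin b) (Fin b) ℂ) : Matrix (Fin (a + b)) (Fin (a + b)) ℂ :=
  Matrix.reindexAlgEquiv ℂ ℂ finSumFinEquiv (Matrix.fromBlocks X 0 0 Y)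

theorem bd_one : bd (1 : Matrix (Fin a) (Fin a) ℂ) (1 : Matrix (Fin b) (Fin b) ℂ) = 1 := by
  simp [bd, Matrix.fromBlocks_one]

theorem bd_mul (X X' : Matrix (Fin a) (Fin a) ℂ) (Y Y' : Matrix (Fin b) (Fin b) ℂ) :
    bd X Y * bd X' Y' = bd (X * X') (Y * Y') := by
  unfold bd
  rw [← map_mul, Matrix.fromBlocks_multiply]
  simp

theorem bd_eq_zero_iff (X : Matrix (Fin a) (Fin a) ℂ) (Y : Matrix (Fin b) (Fin b) ℂ) :
    bd X Y = 0 ↔ X = 0 ∧ Y = 0 := by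
  unfold bd
  rw [map_eq_zero_iff _ (AlgEquiv.injective _)]
  constructor
  · intro h
    refine ⟨?_, ?_⟩
    · ext i j
      have := congrFun (congrFun h (Sum.inl i)) (Sum.inl j)
      simpa using this
    · ext i j
      have := congrFun (congrFun h (Sum.inr i)) (Sum.inr j)
      simpa using this
  · rintro ⟨rfl, rfl⟩
    ext i j
    rcases i with i | i <;> rcases j with j | j <;> simp

/-- Words of a block-diagonal pair are block-diagonal sums of the blocks' words. -/
theorem word_bd (P Q : Matrix (Fin a) (Fin a) ℂ) (P' Q' : Matrix (Fin b) (Fin b) ℂ) (w : List Bool) :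
    word (bd P P') (bd Q Q') w = bd (word P Q w) (word P' Q' w) := by
  induction w with
  | nil => simp [word, bd_one]
  | cons hd tl ih =>
      have hcons : ∀ {m : ℕ} (T₀ T₁ : Matrix (Fin m) (Fin m) ℂ),
          word T₀ T₁ (hd :: tl) = (if hd then T₁ else T₀) * word T₀ T₁ tl := by
        intro m T₀ T₁; simp [word]
      rw [hcons, hcons, hcons, ih]
      cases hd <;> simp [bd_mul]

/-- **PROFILE PROJECTION.**  If every nonzero word of the block-diagonal pair obeys the profile `(r, c, Θ)`, so does every
nonzero word of each block — with the SAME profile. -/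
theorem profile_left_of_bd {P Q : Matrix (Fin a) (Fin a) ℂ} {P' Q' : Matrix (Fin b) (Fin b) ℂ} {r c Θ : ℕ}
    (hw : ∀ w : List Bool, word (bd P P') (bd Q Q') w ≠ 0 → c * w.count true ≤ Θ + r * w.count false) :
    ∀ w : List Bool, word P Q w ≠ 0 → c * w.count true ≤ Θ + r * w.count false := by
  intro w hne
  refine hw w ?_
  rw [word_bd, Ne, bd_eq_zero_iff]
  exact fun h => hne h.1

theorem profile_right_of_bd {P Q : Matrix (Fin a) (Fin a) ℂ} {P' Q' : Matrix (Fin b) (Fin b) ℂ} {r c Θ : ℕ}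
    (hw : ∀ w : List Bool, word (bd P P') (bd Q Q') w ≠ 0 → c * w.count true ≤ Θ + r * w.count false) :
    ∀ w : List Bool, word P' Q' w ≠ 0 → c * w.count true ≤ Θ + r * w.count false := by
  intro w hne
  refine hw w ?_
  rw [word_bd, Ne, bd_eq_zero_iff]
  exact fun h => hne h.2

/-- Word-tameness of a block-diagonal pair descends to each block (same budget `k`; indeed same profile). -/
theorem wordTame_of_bd {n k : ℕ} {P Q : Matrix (Fin a) (Fin a) ℂ} {P' Q' : Matrix (Fin b) (Fin b) ℂ}
    (h : WordTame n k (bd P P') (bd Q Q')) : WordTame n k P Q ∧ WordTame n k P' Q' := by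
  obtain ⟨r, c, Θ, hc, hk, hw⟩ := h
  exact ⟨⟨r, c, Θ, hc, hk, profile_left_of_bd hw⟩, ⟨r, c, Θ, hc, hk, profile_right_of_bd hw⟩⟩


/-! ## Height ⇒ index: the trace-invisible necessity clause (card #2 rev 4, P5 (ii)) -/

theorem word_replicate_true {m : ℕ} (P Q : Matrix (Fin m) (Fin m) ℂ) (u : ℕ) :
    word P Q (List.replicate u true) = Q ^ u := by
  induction u with
  | zero => simp [word]
  | succ u ih =>
      have hcons : ∀ (l : List Bool), word P Q (true :: l) = Q * word P Q l := by
        intro l; simp [word]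
      rw [List.replicate_succ, hcons, ih, pow_succ']

/-- **HEIGHT ⇒ INDEX.**  A word-tame pair with budget `k ≤ n − 2` has `Q ^ (k+1) = 0`: the pure powers `Q^u ≠ 0` force `c·u ≤ Θ`,
and the budget forces `Θ < (k+1)·c`.  (So at budget `k` only directions whose EVERY block component has nilindex `≤ k+1` can serve.) -/
theorem pow_eq_zero_of_wordTame {m n k : ℕ} {P Q : Matrix (Fin m) (Fin m) ℂ} (h : WordTame n k P Q) (hkn : k + 2 ≤ n) :
    Q ^ (k + 1) = 0 := by
  obtain ⟨r, c, Θ, hc, hk, hw⟩ := h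
  by_contra hne
  have h1 := hw (List.replicate (k + 1) true) (by rwa [word_replicate_true])
  have h0 : List.count false (List.replicate (k + 1) true) = 0 :=
    List.count_eq_zero.2 (fun hmem => Bool.noConfusion (List.eq_of_mem_replicate hmem))
  rw [h0, mul_zero, add_zero, List.count_replicate_self] at h1
  have hpos : 0 < c + r := by omega
  have h2 : Θ + r * (n - 1) < (k + 1) * (c + r) :=
    (Nat.div_lt_iff_lt_mul hpos).1 (Nat.lt_succ_of_le hk)
  obtain ⟨N, hN⟩ : ∃ N, n - 1 = N := ⟨_, rfl⟩
  have hNk : k + 1 ≤ N := by omega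
  rw [hN] at h2
  have h3 : r * (k + 1) ≤ r * N := Nat.mul_le_mul_left _ hNk
  nlinarith [h1, h2, h3]

/-! ## The typed necessity statement of the line (proof = KingProcesi T1 + linear algebra; recorded as a `Prop`) -/

/-- The two-letter `θ_k`-NULL CONE of a block: linear-part elements `Q` all of whose `θ_k`-rich two-letter necklaces against
every point `P` of the affine block vanish (`θ_k`-rich: `(k+1)·|w| ≤ (n−1)·#Q`, `#Q > 0`).  A flag-cheap certificate with
budget `k` can only use directions whose block components lie in these cones (T1). -/
def NullCone (n k : ℕ) {m : ℕ} (N : AffMat n m) : Set (Matrix (Fin m) (Fin m) ℂ) :=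
  {Q | ∀ x : Fin n × Fin n → ℂ, ∀ w : List Bool, 0 < w.count true → (k + 1) * w.length ≤ (n - 1) * w.count true →
    Matrix.trace (word ((N.map (MvPolynomial.eval x))) Q w) = 0}

/-- Block-diagonal sum of two affine pencils on the same parameter space. -/
noncomputable def bdAff {n : ℕ} (N₁ : AffMat n a) (N₂ : AffMat n b) : AffMat n (a + b) :=
  Matrix.reindexAlgEquiv ℂ (MvPolynomial (Fin n × Fin n) ℂ) finSumFinEquiv (Matrix.fromBlocks N₁ 0 0 N₂)

/-- **MIXING NECESSITY (typed target of the line).**  If the block sum is flag-cheap then for some budget `k ≤ n − 2` there are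
LINEAR subspaces `U₁, U₂` of the two null cones whose dimensions, together with the common kernel of the linear parts, exceed
the budget `(k+1)·n`.  (So `FlagCheap` of a relabelled semisimple sum forces `Σ_blocks λ_{θ_k}(block) > (k+1)n − dim ker`.) -/
def MixingNecessity : Prop :=
  ∀ (n a b : ℕ) (N₁ : AffMat n a) (N₂ : AffMat n b), IsAffine N₁ → IsAffine N₂ →
    FlagCheap n (a + b) (bdAff N₁ N₂) →
    ∃ (k : ℕ) (U₁ : Submodule ℂ (Matrix (Fin a) (Fin a) ℂ)) (U₂ : Submodule ℂ (Matrix (Fin b) (Fin b) ℂ))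
      (Z : Submodule ℂ (Fin n × Fin n → ℂ)),
      k + 2 ≤ n ∧ (U₁ : Set _) ⊆ NullCone n k N₁ ∧ (U₂ : Set _) ⊆ NullCone n k N₂ ∧
      (∀ Q ∈ U₁, Q ^ (k + 1) = 0) ∧ (∀ Q ∈ U₂, Q ^ (k + 1) = 0) ∧
      (∀ v ∈ Z, linPart N₁ v = 0 ∧ linPart N₂ v = 0) ∧
      (k + 1) * n < Module.finrank ℂ U₁ + Module.finrank ℂ U₂ + Module.finrank ℂ Z

end Summit.ValiantsHypothesis.ValiantsHypothesis.Cruxes.DualUnipotentThreeHalves.Mixing
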